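import Mathlib.Analysis.Normed.Group.Basic
import Mathlib.Analysis.Normed.Field.Basic
import Literature.MathematicalPhysics.QuantumFieldTheory.TorusChartCentredSweep
import HarnessLib

/-!
# The degree-two Poincaré lemma on a charted torus WITH GROWTH CONTROL

`TorusChartCurlPrimitive.lean` proves that an alternating, closed, zero-flux `2`-cochain `q` on a charted torus
`F : TorusChart Λ d` is a curl; `TorusChartCentredSweep.lean` sets up the centred sweep `csweep κ q` (partial sums of the
rows from the CENTRE layer `{x_κ = ⌊N_κ/2⌋}`) and its remainder `crem κ q` (explicitly `q` read at the centre point, off the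
pairs involving `κ`).  Here the sizes are tracked — the growth-controlled primitive that the estimates of constructive
field theory need (a potential fed into an exponentially localised kernel, [BalabanImbrieJaffe1985] p. 326 *"by change
of gauge u_k can be transformed in a local region Λ into a configuration of the form exp[ie_kηA], where A is smooth and
small"*, [BalabanImbrieJaffe1988] (6.1.5)), uniformly in the volume:

* `‖crem κ q‖_∞ ≤ ‖q‖_∞` (`norm_crem_le`) — what makes the induction quantitative;
* `‖csweep κ q (x, j)‖ ≤ |x_κ - ⌊N_κ/2⌋|·‖q‖_∞` for `j ≠ κ` (`norm_csweep_of_ne_le`); the `κ`-component lives on the last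
  `κ`-layer only, where it is at most `(Σ_i x_i)·N_κ·‖q‖_∞` (`norm_csweep_self_le`, via `norm_prim_le`, `norm_rowCirc_le`);
* **`TorusChart.exists_d₁_eq_of_closed_bound`**: an alternating closed zero-flux `q` with `‖q‖_∞ ≤ s` is `d₁ θ` with
  `‖θ (x, j)‖ ≤ s·(cdist x + seamW x j)`, `cdist x = Σ_κ |x_κ - ⌊N_κ/2⌋|` the `ℓ¹` distance to the centre of the chart
  box and `seamW x j = [x_j = N_j - 1]·(Σ_i x_i)·N_j` (non-zero only on the last `j`-layer, i.e. at `j`-distance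
  `≥ N_j/2 - 1` from the centre);
* **`TorusChart.exists_const₂_add_d₁_of_closed`** (real coefficients): every alternating closed `q` with `|q| ≤ s` is
  `const₂ (fluxAvg q) + d₁ θ` with the constant (harmonic) part the flux averages, `|fluxAvg q i j| ≤ s`, and
  `|θ (x, j)| ≤ 2s·(cdist x + seamW x j)` — the discrete de Rham statement `H²(𝕋^d; ℝ) ≅ ℝ^{d(d-1)/2}` with sizes.

Everything is proved; no named fact is introduced; the statements are elementary (discrete de Rham calculus) and carry the
locator of the gauge choice of [BalabanImbrieJaffe1985] p. 326 which they implement (private plumbing is [folklore]).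
statement-level skeleton of published theorems with citation tags; proofs where landed; nothing here is a claim about the
Yang–Mills mass gap.

## References

* B. Eckmann, Comment. Math. Helv. 17 (1945) 240–255 (cohomology of finite cell complexes). [folklore form]
* T. Bałaban, J. Imbrie, A. Jaffe, Commun. Math. Phys. 97 (1985) 299–329, p. 326. [BalabanImbrieJaffe1985]
* T. Bałaban, J. Imbrie, A. Jaffe, Commun. Math. Phys. 114 (1988) 257–315, (6.1.5). [BalabanImbrieJaffe1988]
-/

namespace Literature.MathematicalPhysics.QuantumFieldTheory

open scoped BigOperators

namespace TorusChart

variable {Λ : Type*} [AddCommGroup Λ] {d : ℕ} (F : TorusChart Λ d)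


/-! ## Sizes -/

section Bounds

variable {A : Type*} [SeminormedAddCommGroup A]

omit [AddCommGroup Λ] in
/-- Two partial sums of a bounded sequence differ by at most (number of differing terms) × (bound). [cite: BalabanImbrieJaffe1985, §7.3 p.326] -/
theorem norm_sum_range_sub_sum_range_le (f : ℕ → A) {s : ℝ} (hf : ∀ m, ‖f m‖ ≤ s) (a b : ℕ) :
    ‖∑ m ∈ Finset.range a, f m - ∑ m ∈ Finset.range b, f m‖ ≤ |(a : ℝ) - b| * s := by
  wlog hba : b ≤ a generalizing a b
  · rw [norm_sub_rev, abs_sub_comm]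
    exact this b a (le_of_lt (not_le.mp hba))
  rw [← Finset.sum_Ico_eq_sub _ hba, ← Nat.cast_sub hba, Nat.abs_cast]
  refine (norm_sum_le _ _).trans ?_
  have h := Finset.sum_le_card_nsmul (Finset.Ico b a) (fun m => ‖f m‖) s fun m _ => hf m
  rw [Nat.card_Ico, nsmul_eq_mul] at h
  exact h

/-- A circle sum of a bounded function is at most `N_κ` × (bound). [cite: BalabanImbrieJaffe1985, §7.3 p.326] -/
theorem norm_circSum_le (κ : Fin d) {h : Λ → A} {t : ℝ} (ht : ∀ y, ‖h y‖ ≤ t) (x : Λ) :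
    ‖F.circSum κ h x‖ ≤ F.period κ * t := by
  rw [circSum_def]
  refine (norm_sum_le _ _).trans ?_
  have h1 := Finset.sum_le_card_nsmul (Finset.range (F.period κ)) (fun m => ‖h (F.dropCoord κ x + m • F.gen κ)‖) t
    fun m _ => ht _
  rw [Finset.card_range, nsmul_eq_mul] at h1
  exact h1

/-- The row circle sums of a bounded `2`-cochain are at most `N_κ·‖q‖_∞`. [cite: BalabanImbrieJaffe1985, §7.3 p.326] -/
theorem norm_rowCirc_le (κ : Fin d) {q : Λ → Fin d → Fin d → A} {s : ℝ} (hs : ∀ x i j, ‖q x i j‖ ≤ s) (x : Λ)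
    (j : Fin d) : ‖F.rowCirc κ q x j‖ ≤ F.period κ * s := by
  have hs0 : 0 ≤ s := (norm_nonneg _).trans (hs x j j)
  by_cases hj : j = κ
  · rw [hj, rowCirc_self, norm_zero]; exact mul_nonneg (Nat.cast_nonneg _) hs0
  · rw [F.rowCirc_of_ne κ q x hj, norm_neg]
    exact F.norm_circSum_le κ (fun y => hs y κ j) x

/-- A line sum of `n` edges of a bounded cochain is at most `n` × (bound). [cite: BalabanImbrieJaffe1985, §7.3 p.326] -/
theorem norm_lineSum_le {θ : Λ → Fin d → A} {t : ℝ} (ht : ∀ y i, ‖θ y i‖ ≤ t) (i : Fin d) (n : ℕ) (y : Λ) :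
    ‖F.lineSum θ i n y‖ ≤ n * t := by
  rw [lineSum]
  refine (norm_sum_le _ _).trans ?_
  have h1 := Finset.sum_le_card_nsmul (Finset.range n) (fun k => ‖θ (y + k • F.gen i) i‖) t fun k _ => ht _ _
  rw [Finset.card_range, nsmul_eq_mul] at h1
  exact h1

/-- The staircase sum after `n` directions is bounded by (number of edges traversed) × (bound). [cite: BalabanImbrieJaffe1985, §7.3 p.326] -/
theorem norm_axPrim_le {θ : Λ → Fin d → A} {t : ℝ} (ht : ∀ y i, ‖θ y i‖ ≤ t) (x : Λ) :
    ∀ n : ℕ, ‖F.axPrim θ x n‖ ≤ (∑ i : Fin d, if (i : ℕ) < n then (F.cval i x : ℝ) else 0) * t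
  | 0 => by simp
  | n + 1 => by
    have IH := norm_axPrim_le ht x n
    have hsplit : (∑ i : Fin d, if (i : ℕ) < n + 1 then (F.cval i x : ℝ) else 0) =
        (∑ i : Fin d, if (i : ℕ) < n then (F.cval i x : ℝ) else 0) +
          ∑ i : Fin d, if (i : ℕ) = n then (F.cval i x : ℝ) else 0 := by
      rw [← Finset.sum_add_distrib]
      refine Finset.sum_congr rfl fun i _ => ?_
      rcases lt_trichotomy (i : ℕ) n with h | h | h
      · rw [if_pos (Nat.lt_succ_of_lt h), if_pos h, if_neg (ne_of_lt h), add_zero]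
      · rw [if_pos (h ▸ Nat.lt_succ_self n), if_neg (h ▸ lt_irrefl _), if_pos h, zero_add]
      · rw [if_neg (by omega), if_neg (by omega), if_neg (by omega), add_zero]
    rw [axPrim_succ, hsplit, add_mul]
    refine (norm_add_le _ _).trans (add_le_add IH ?_)
    split_ifs with hn
    · have hsum1 : (∑ i : Fin d, if (i : ℕ) = n then (F.cval i x : ℝ) else 0) = F.cval ⟨n, hn⟩ x := by
        rw [Finset.sum_eq_single_of_mem (⟨n, hn⟩ : Fin d) (Finset.mem_univ _) fun i _ hi =>
          if_neg fun h => hi (Fin.ext h)]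
        exact if_pos rfl
      rw [hsum1]
      exact F.norm_lineSum_le ht _ _ _
    · rw [norm_zero]
      have : (∑ i : Fin d, if (i : ℕ) = n then (F.cval i x : ℝ) else 0) = 0 :=
        Finset.sum_eq_zero fun i _ => by
          rw [if_neg]
          intro h
          exact hn (by rw [← h]; exact i.isLt)
      rw [this, zero_mul]

/-- **The axial primitive of a bounded cochain grows at most like the staircase length**:
`‖prim θ x‖ ≤ (Σ_i x_i)·‖θ‖_∞`. [cite: BalabanImbrieJaffe1985, §7.3 p.326] -/
theorem norm_prim_le {θ : Λ → Fin d → A} {t : ℝ} (ht : ∀ y i, ‖θ y i‖ ≤ t) (x : Λ) :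
    ‖F.prim θ x‖ ≤ (∑ i : Fin d, (F.cval i x : ℝ)) * t := by
  have h := F.norm_axPrim_le ht x d
  simp only [Fin.is_lt, if_true] at h
  exact h

/-- **Growth of the centred sweep, transverse components**: `‖csweep κ q (x, j)‖ ≤ |x_κ - ⌊N_κ/2⌋|·‖q‖_∞` for `j ≠ κ`.
[cite: BalabanImbrieJaffe1985, §7.3 p.326] -/
theorem norm_csweep_of_ne_le (κ : Fin d) {q : Λ → Fin d → Fin d → A} {s : ℝ} (hs : ∀ x i j, ‖q x i j‖ ≤ s)
    (x : Λ) {j : Fin d} (hj : j ≠ κ) :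
    ‖F.csweep κ q x j‖ ≤ |(F.cval κ x : ℝ) - (F.period κ / 2 : ℕ)| * s := by
  rw [F.csweep_of_ne κ q x hj, axSum_def, axSum_def, dropCoord_mid, cval_mid_self]
  exact norm_sum_range_sub_sum_range_le _ (fun m => hs _ κ j) _ _

/-- **Growth of the centred sweep, the `κ`-component**: supported on the last `κ`-layer, where it is at most
`(Σ_i x_i)·N_κ·‖q‖_∞`. [cite: BalabanImbrieJaffe1985, §7.3 p.326] -/
theorem norm_csweep_self_le (κ : Fin d) {q : Λ → Fin d → Fin d → A} {s : ℝ} (hs : ∀ x i j, ‖q x i j‖ ≤ s)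
    (x : Λ) :
    ‖F.csweep κ q x κ‖ ≤
      if F.cval κ x + 1 = F.period κ then (∑ i : Fin d, (F.cval i x : ℝ)) * (F.period κ * s) else 0 := by
  rw [csweep_self]
  split_ifs with hx
  · exact F.norm_prim_le (fun y i => F.norm_rowCirc_le κ hs y i) x
  · rw [norm_zero]

variable {F} in
/-- **The remainder is not larger than `q`**: `‖crem κ q‖_∞ ≤ ‖q‖_∞`. [cite: BalabanImbrieJaffe1985, §7.3 p.326] -/
theorem norm_crem_le (κ : Fin d) {q : Λ → Fin d → Fin d → A} (halt : IsAlt₂ q) (hq : F.d₂ q = 0)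
    (hflux : ∀ j, F.flux q κ j = 0) {s : ℝ} (hs : ∀ x i j, ‖q x i j‖ ≤ s) (x : Λ) (i j : Fin d) :
    ‖F.crem κ q x i j‖ ≤ s := by
  rw [crem_apply κ halt hq hflux]
  split_ifs
  · rw [norm_zero]; exact (norm_nonneg _).trans (hs x i j)
  · exact hs _ i j

/-! ## The quantitative induction -/

/-- The `ℓ¹` **distance to the centre of the chart box**: `cdist x = Σ_κ |x_κ - ⌊N_κ/2⌋|`. [cite: BalabanImbrieJaffe1985, §7.3 p.326] -/
def cdist (x : Λ) : ℝ := ∑ κ : Fin d, |(F.cval κ x : ℝ) - (F.period κ / 2 : ℕ)|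

/-- The **seam weight** in direction `j`: `(Σ_i x_i)·N_j` on the last `j`-layer, `0` elsewhere. [cite: BalabanImbrieJaffe1985, §7.3 p.326] -/
def seamW (x : Λ) (j : Fin d) : ℝ :=
  if F.cval j x + 1 = F.period j then (∑ i : Fin d, (F.cval i x : ℝ)) * F.period j else 0

/-- `cdist` is non-negative. [cite: BalabanImbrieJaffe1985, §7.3 p.326] -/
theorem cdist_nonneg (x : Λ) : 0 ≤ F.cdist x := Finset.sum_nonneg fun _ _ => abs_nonneg _

/-- `seamW` is non-negative. [cite: BalabanImbrieJaffe1985, §7.3 p.326] -/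
theorem seamW_nonneg (x : Λ) (j : Fin d) : 0 ≤ F.seamW x j := by
  unfold seamW
  split_ifs
  · exact mul_nonneg (Finset.sum_nonneg fun _ _ => Nat.cast_nonneg _) (Nat.cast_nonneg _)
  · exact le_rfl

/-- The accumulated bound after sweeping the directions `≥ d - n`. [folklore] -/
private def bnd (n : ℕ) (x : Λ) (j : Fin d) : ℝ :=
  (∑ κ : Fin d, if d - n ≤ (κ : ℕ) ∧ κ ≠ j then |(F.cval κ x : ℝ) - (F.period κ / 2 : ℕ)| else 0) +
    if d - n ≤ (j : ℕ) then F.seamW x j else 0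

/-- The accumulated bound is non-negative. [folklore] -/
private theorem bnd_nonneg (n : ℕ) (x : Λ) (j : Fin d) : 0 ≤ F.bnd n x j := by
  unfold bnd
  refine add_nonneg (Finset.sum_nonneg fun κ _ => ?_) ?_
  · split_ifs; exacts [abs_nonneg _, le_rfl]
  · split_ifs; exacts [F.seamW_nonneg x j, le_rfl]

/-- One more direction swept, transverse component: the bound gains the distance term of that direction. [folklore] -/
private theorem bnd_succ_of_ne {n : ℕ} (hn : n + 1 ≤ d) (x : Λ) {j κ₀ : Fin d} (hκ₀ : (κ₀ : ℕ) = d - (n + 1))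
    (hj : j ≠ κ₀) : F.bnd n x j + |(F.cval κ₀ x : ℝ) - (F.period κ₀ / 2 : ℕ)| ≤ F.bnd (n + 1) x j := by
  unfold bnd
  have hjs : (d - n ≤ (j : ℕ)) ↔ (d - (n + 1) ≤ (j : ℕ)) := by
    constructor
    · intro h; omega
    · intro h
      rcases Nat.eq_or_lt_of_le h with h' | h'
      · exact absurd (Fin.ext (hκ₀.trans h')) (Ne.symm hj)
      · omega
  rw [if_congr hjs rfl rfl, add_right_comm, add_le_add_iff_right]
  -- the sums: every term only grows, and the `κ₀` term grows by the full distance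
  let g : Fin d → ℝ := fun κ =>
    (if d - (n + 1) ≤ (κ : ℕ) ∧ κ ≠ j then |(F.cval κ x : ℝ) - (F.period κ / 2 : ℕ)| else 0) -
      (if d - n ≤ (κ : ℕ) ∧ κ ≠ j then |(F.cval κ x : ℝ) - (F.period κ / 2 : ℕ)| else 0)
  have hg : ∀ κ, 0 ≤ g κ := fun κ => by
    simp only [g]
    by_cases h2 : d - n ≤ (κ : ℕ) ∧ κ ≠ j
    · have h21 := h2.1
      have h1 : d - (n + 1) ≤ (κ : ℕ) ∧ κ ≠ j := ⟨by omega, h2.2⟩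
      rw [if_pos h1, if_pos h2, sub_self]
    · rw [if_neg h2, sub_zero]
      split_ifs
      · exact abs_nonneg _
      · exact le_rfl
  have hg0 : g κ₀ = |(F.cval κ₀ x : ℝ) - (F.period κ₀ / 2 : ℕ)| := by
    simp only [g]
    have hno : ¬ (d - n ≤ (κ₀ : ℕ) ∧ κ₀ ≠ j) := fun h => by have := h.1; omega
    rw [if_pos ⟨le_of_eq hκ₀.symm, Ne.symm hj⟩, if_neg hno, sub_zero]
  have hsum : (∑ κ : Fin d, g κ) =
      (∑ κ : Fin d, if d - (n + 1) ≤ (κ : ℕ) ∧ κ ≠ j then |(F.cval κ x : ℝ) - (F.period κ / 2 : ℕ)| else 0) -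
        ∑ κ : Fin d, if d - n ≤ (κ : ℕ) ∧ κ ≠ j then |(F.cval κ x : ℝ) - (F.period κ / 2 : ℕ)| else 0 := by
    simp only [g, Finset.sum_sub_distrib]
  have hle : g κ₀ ≤ ∑ κ : Fin d, g κ := Finset.single_le_sum (fun κ _ => hg κ) (Finset.mem_univ κ₀)
  rw [hg0, hsum] at hle
  linarith

/-- One more direction swept, that very component: the bound gains the seam weight. [folklore] -/
private theorem bnd_succ_self {n : ℕ} (hn : n + 1 ≤ d) (x : Λ) {κ₀ : Fin d} (hκ₀ : (κ₀ : ℕ) = d - (n + 1)) :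
    F.bnd n x κ₀ + F.seamW x κ₀ ≤ F.bnd (n + 1) x κ₀ := by
  unfold bnd
  have hno : ¬ d - n ≤ (κ₀ : ℕ) := fun h => by omega
  rw [if_neg hno, add_zero, if_pos (le_of_eq hκ₀.symm)]
  refine add_le_add (Finset.sum_le_sum fun κ _ => ?_) le_rfl
  by_cases h1 : d - n ≤ (κ : ℕ) ∧ κ ≠ κ₀
  · have h11 := h1.1
    have h2 : d - (n + 1) ≤ (κ : ℕ) ∧ κ ≠ κ₀ := ⟨by omega, h1.2⟩
    rw [if_pos h1, if_pos h2]
  · rw [if_neg h1]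
    split_ifs
    · exact abs_nonneg _
    · exact le_rfl

/-- The final accumulated bound is at most `cdist x + seamW x j`. [folklore] -/
private theorem bnd_le (x : Λ) (j : Fin d) : F.bnd d x j ≤ F.cdist x + F.seamW x j := by
  unfold bnd cdist
  rw [Nat.sub_self, if_pos (Nat.zero_le _)]
  refine add_le_add (Finset.sum_le_sum fun κ _ => ?_) le_rfl
  split_ifs
  · exact le_rfl
  · exact abs_nonneg _

variable {F} in
/-- **Sweeping out the directions with sizes.** An alternating closed zero-flux `2`-cochain bounded by `s` and vanishing
on all pairs involving a direction `< d - n` is `d₁ θ` with `‖θ (x, j)‖ ≤ s·bnd n x j` (induction on `n`, one centred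
sweep per direction, the remainder staying bounded by `s`). [folklore] -/
private theorem exists_d₁_eq_of_vanish_bound {s : ℝ} :
    ∀ (n : ℕ), n ≤ d → ∀ q : Λ → Fin d → Fin d → A, IsAlt₂ q → F.d₂ q = 0 → (∀ i j, F.flux q i j = 0) →
      (∀ x i j, ‖q x i j‖ ≤ s) → (∀ (x : Λ) (i j : Fin d), (i : ℕ) < d - n → q x i j = 0) →
      ∃ θ : Λ → Fin d → A, F.d₁ θ = q ∧ ∀ x j, ‖θ x j‖ ≤ s * F.bnd n x j
  | 0, _, q, _, _, _, hs, hvan => by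
    refine ⟨0, ?_, fun x j => ?_⟩
    · rw [d₁_zero]
      funext x i j
      exact (hvan x i j (by rw [Nat.sub_zero]; exact i.isLt)).symm
    · rw [Pi.zero_apply, Pi.zero_apply, norm_zero]
      exact mul_nonneg ((norm_nonneg _).trans (hs x j j)) (F.bnd_nonneg 0 x j)
  | n + 1, hn, q, halt, hq, hflux, hs, hvan => by
    have hk : d - (n + 1) < d := by omega
    obtain ⟨κ, hκ⟩ : ∃ κ : Fin d, (κ : ℕ) = d - (n + 1) := ⟨⟨d - (n + 1), hk⟩, rfl⟩
    have hs0 : 0 ≤ s := (norm_nonneg _).trans (hs 0 κ κ)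
    -- the remainder after the centred sweep in direction `κ`
    have halt' : IsAlt₂ (F.crem κ q) := isAlt₂_crem κ halt
    have hq' : F.d₂ (F.crem κ q) = 0 := F.d₂_crem κ hq
    have hflux' : ∀ i j, F.flux (F.crem κ q) i j = 0 := fun i j => by rw [flux_crem, hflux]
    have hs' : ∀ x i j, ‖F.crem κ q x i j‖ ≤ s := norm_crem_le κ halt hq (hflux κ) hs
    have hvan' : ∀ (x : Λ) (i j : Fin d), (i : ℕ) < d - n → F.crem κ q x i j = 0 := by
      intro x i j hi
      rcases Nat.lt_or_ge (i : ℕ) (d - (n + 1)) with hlt | hge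
      · exact crem_of_vanish κ halt hq (hflux κ) (fun y => hvan y i j hlt) x
      · have hieq : i = κ := Fin.ext (by omega)
        subst hieq
        exact crem_row i halt hq (hflux i) x j
    obtain ⟨θ₂, hθ₂, hb₂⟩ := exists_d₁_eq_of_vanish_bound n (Nat.le_of_succ_le hn) _ halt' hq' hflux' hs' hvan'
    refine ⟨F.csweep κ q + θ₂, ?_, fun x j => ?_⟩
    · rw [d₁_add, hθ₂, crem, add_sub_cancel]
    · rw [Pi.add_apply, Pi.add_apply]
      refine (norm_add_le _ _).trans ?_
      by_cases hj : j = κ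
      · subst hj
        have h1 := F.norm_csweep_self_le j hs x
        have h2 : ‖F.csweep j q x j‖ ≤ s * F.seamW x j := by
          refine h1.trans (le_of_eq ?_)
          unfold seamW
          split_ifs <;> ring
        calc ‖F.csweep j q x j‖ + ‖θ₂ x j‖ ≤ s * F.seamW x j + s * F.bnd n x j := add_le_add h2 (hb₂ x j)
          _ = s * (F.bnd n x j + F.seamW x j) := by ring
          _ ≤ s * F.bnd (n + 1) x j := mul_le_mul_of_nonneg_left (F.bnd_succ_self hn x hκ) hs0
      · have h1 := F.norm_csweep_of_ne_le κ hs x hj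
        calc ‖F.csweep κ q x j‖ + ‖θ₂ x j‖
            ≤ |(F.cval κ x : ℝ) - (F.period κ / 2 : ℕ)| * s + s * F.bnd n x j := add_le_add h1 (hb₂ x j)
          _ = s * (F.bnd n x j + |(F.cval κ x : ℝ) - (F.period κ / 2 : ℕ)|) := by ring
          _ ≤ s * F.bnd (n + 1) x j := mul_le_mul_of_nonneg_left (F.bnd_succ_of_ne hn x hκ hj) hs0

variable {F} in
/-- **The degree-two Poincaré lemma on a charted torus with growth control.** An alternating, closed, zero-flux
`2`-cochain bounded by `s` is the curl of a `1`-cochain `θ` with `‖θ (x, j)‖ ≤ s·(cdist x + seamW x j)`: linear growth in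
the `ℓ¹` distance to the centre of the chart box, plus a seam term living on the last `j`-layer only. [cite: BalabanImbrieJaffe1985, §7.3 p.326] -/
theorem exists_d₁_eq_of_closed_bound {q : Λ → Fin d → Fin d → A} (halt : IsAlt₂ q) (hq : F.d₂ q = 0)
    (hflux : ∀ i j, F.flux q i j = 0) {s : ℝ} (hs : ∀ x i j, ‖q x i j‖ ≤ s) :
    ∃ θ : Λ → Fin d → A, F.d₁ θ = q ∧ ∀ x j, ‖θ x j‖ ≤ s * (F.cdist x + F.seamW x j) := by
  obtain ⟨θ, hθ, hb⟩ := exists_d₁_eq_of_vanish_bound d le_rfl q halt hq hflux hs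
    fun x i j hi => absurd hi (by omega)
  refine ⟨θ, hθ, fun x j => (hb x j).trans ?_⟩
  exact mul_le_mul_of_nonneg_left (F.bnd_le x j) ((norm_nonneg _).trans (hs x j j))

end Bounds

/-! ## Real coefficients: the constant (harmonic) part and the decomposition with sizes -/

section Real

/-- The **flux averages** `flux q i j / (N_i N_j)` of a real `2`-cochain: the value of its constant (harmonic) part.
[cite: BalabanImbrieJaffe1985, §7.3 p.326] -/
noncomputable def fluxAvg (q : Λ → Fin d → Fin d → ℝ) (i j : Fin d) : ℝ :=
  F.flux q i j / (F.period i * F.period j)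

/-- The flux, unfolded as a plain double sum over the coordinate `2`-torus through the origin. [cite: BalabanImbrieJaffe1985, §7.3 p.326] -/
theorem flux_eq_sum_sum {A : Type*} [AddCommGroup A] (q : Λ → Fin d → Fin d → A) {i j : Fin d} (hij : i ≠ j) :
    F.flux q i j = ∑ m ∈ Finset.range (F.period j), ∑ n ∈ Finset.range (F.period i),
      q (m • F.gen j + n • F.gen i) i j := by
  rw [flux_def]
  exact Finset.sum_congr rfl fun m _ => F.circSum_nsmul_gen_of_ne (Ne.symm hij) _ m

/-- The flux of a bounded real cochain is at most `N_i N_j` × (bound). [cite: BalabanImbrieJaffe1985, §7.3 p.326] -/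
theorem abs_flux_le (q : Λ → Fin d → Fin d → ℝ) {s : ℝ} (hs : ∀ x i j, |q x i j| ≤ s) (i j : Fin d) :
    |F.flux q i j| ≤ F.period i * F.period j * s := by
  rw [flux_def]
  refine (Finset.abs_sum_le_sum_abs _ _).trans ?_
  have h1 : ∀ m ∈ Finset.range (F.period j), |F.circSum i (fun y => q y i j) (m • F.gen j)| ≤ F.period i * s :=
    fun m _ => by
      rw [← Real.norm_eq_abs]
      exact F.norm_circSum_le i (fun y => by rw [Real.norm_eq_abs]; exact hs y i j) _
  refine (Finset.sum_le_card_nsmul _ _ _ h1).trans (le_of_eq ?_)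
  rw [Finset.card_range, nsmul_eq_mul]
  ring

/-- **The flux averages of a bounded cochain are bounded by the same constant.** [cite: BalabanImbrieJaffe1985, §7.3 p.326] -/
theorem abs_fluxAvg_le (q : Λ → Fin d → Fin d → ℝ) {s : ℝ} (hs : ∀ x i j, |q x i j| ≤ s) (i j : Fin d) :
    |F.fluxAvg q i j| ≤ s := by
  have hN : (0 : ℝ) < F.period i * F.period j := by
    have := F.period_pos i; have := F.period_pos j; positivity
  rw [fluxAvg, abs_div, abs_of_pos hN, div_le_iff₀ hN]
  calc |F.flux q i j| ≤ F.period i * F.period j * s := F.abs_flux_le q hs i j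
    _ = s * (F.period i * F.period j) := by ring

/-- The flux averages of an alternating cochain have zero diagonal. [cite: BalabanImbrieJaffe1985, §7.3 p.326] -/
theorem fluxAvg_self {q : Λ → Fin d → Fin d → ℝ} (halt : IsAlt₂ q) (i : Fin d) : F.fluxAvg q i i = 0 := by
  unfold fluxAvg
  rw [flux_def]
  simp only [circSum_def, halt.diag, Finset.sum_const_zero, zero_div]

/-- The flux averages of an alternating cochain are antisymmetric. [cite: BalabanImbrieJaffe1985, §7.3 p.326] -/
theorem fluxAvg_swap {q : Λ → Fin d → Fin d → ℝ} (halt : IsAlt₂ q) (i j : Fin d) :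
    F.fluxAvg q j i = -F.fluxAvg q i j := by
  by_cases hij : i = j
  · subst hij; rw [F.fluxAvg_self halt, neg_zero]
  unfold fluxAvg
  rw [F.flux_eq_sum_sum q hij, F.flux_eq_sum_sum q (Ne.symm hij), Finset.sum_comm, mul_comm,
    ← neg_div, ← Finset.sum_neg_distrib]
  congr 1
  refine Finset.sum_congr rfl fun m _ => ?_
  rw [← Finset.sum_neg_distrib]
  refine Finset.sum_congr rfl fun n _ => ?_
  rw [add_comm, halt.swap]

/-- Subtracting its flux averages kills the fluxes of a real cochain. [cite: BalabanImbrieJaffe1985, §7.3 p.326] -/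
theorem flux_sub_const₂_fluxAvg (q : Λ → Fin d → Fin d → ℝ) (i j : Fin d) :
    F.flux (q - F.const₂ (F.fluxAvg q)) i j = 0 := by
  have hN : (F.period i : ℝ) * F.period j ≠ 0 := by
    have := F.period_pos i; have := F.period_pos j; positivity
  rw [flux_sub, flux_const₂]
  unfold fluxAvg
  rw [nsmul_eq_mul, Nat.cast_mul, mul_comm (F.period j : ℝ), mul_div_cancel₀ _ hN, sub_self]

variable {F} in
/-- **The discrete de Rham decomposition in degree two, with sizes.** Every alternating closed real `2`-cochain `q`
with `|q| ≤ s` on a charted torus is its constant flux-average part plus a curl, `q = const₂ (fluxAvg q) + d₁ θ`, with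
`|fluxAvg q i j| ≤ s` (`abs_fluxAvg_le`) and `|θ (x, j)| ≤ 2s·(cdist x + seamW x j)`. [cite: BalabanImbrieJaffe1985, §7.3 p.326] -/
theorem exists_const₂_add_d₁_of_closed {q : Λ → Fin d → Fin d → ℝ} (halt : IsAlt₂ q) (hq : F.d₂ q = 0) {s : ℝ}
    (hs : ∀ x i j, |q x i j| ≤ s) :
    ∃ θ : Λ → Fin d → ℝ, q = F.const₂ (F.fluxAvg q) + F.d₁ θ ∧
      ∀ x j, |θ x j| ≤ 2 * s * (F.cdist x + F.seamW x j) := by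
  have halt' : IsAlt₂ (q - F.const₂ (F.fluxAvg q)) :=
    halt.sub (F.isAlt₂_const₂ (F.fluxAvg_self halt) (F.fluxAvg_swap halt))
  have hq' : F.d₂ (q - F.const₂ (F.fluxAvg q)) = 0 := by rw [d₂_sub, hq, d₂_const₂, sub_zero]
  have hs' : ∀ x i j, ‖(q - F.const₂ (F.fluxAvg q)) x i j‖ ≤ 2 * s := fun x i j => by
    rw [Pi.sub_apply, Pi.sub_apply, Pi.sub_apply, const₂_apply, Real.norm_eq_abs]
    calc |q x i j - F.fluxAvg q i j| ≤ |q x i j| + |F.fluxAvg q i j| := abs_sub _ _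
      _ ≤ s + s := add_le_add (hs x i j) (F.abs_fluxAvg_le q hs i j)
      _ = 2 * s := by ring
  obtain ⟨θ, hθ, hb⟩ := exists_d₁_eq_of_closed_bound halt' hq' (F.flux_sub_const₂_fluxAvg q) hs'
  refine ⟨θ, by rw [hθ, add_sub_cancel], fun x j => ?_⟩
  rw [← Real.norm_eq_abs]
  exact hb x j

end Real

end TorusChart

end Literature.MathematicalPhysics.QuantumFieldTheory
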